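import Literature.AlgebraicGeometry.Motives.CorrespondencesTransposeProofs
import HarnessLib

/-!
# Discharged fact: composites of algebraic correspondences are algebraic

`Literature.AlgebraicGeometry.Motives.Correspondences` records as a named fact (D-0014)
`Literature.AlgebraicGeometry.Motives.WeilCohomology.isAlgebraicGradedOp_comp : Prop` — for a Weil
cohomology theory `W` and smooth projective `X`, `Y`, `Z` of dimensions `nX`, `nY`, `nZ`: if the
graded operators `T : H•(X) → H•(Y)` and `S : H•(Y) → H•(Z)` are induced by algebraic
correspondences with `ℚ`-coefficients, so is `S ∘ T`, the composite being induced by the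
composite correspondences `v ∘ u = p₁₃₊ (p₁₂* u ∪ p₂₃* v)` (S. Kleiman, *Algebraic cycles and the
Weil conjectures* (1968), §1.3; W. Fulton, *Intersection theory*, Def. 16.1.1 and
Prop. 16.1.2 (a) `(β ∘ α)_* = β_* ∘ α_*`; B. Kahn, *Zeta and L-functions of varieties and
motives* (2020), §3.5.1 (push-forward as the Poincaré-duality adjoint of pull-back) and
Prop. 3.45 / (3.5.1)–(3.5.2)). This file **proves** it
(`WeilCohomology.isAlgebraicGradedOp_comp_holds`), on top of the tools of
`CorrespondencesTransposeProofs` (Künneth induction, the transpose lemma).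

## The argument (formal in the axioms of `WeilCohomology`)

Throughout `T : Hⁱ(X) → Hᵐ(Y)` is induced by `u ∈ H²ᵃ(X × Y)` and `S : Hᵐ(Y) → Hʲ(Z)` by
`v ∈ H²ᵇ(Y × Z)`, in Kleiman's pairing form `tr_Y (T x ∪ y) = tr_{X×Y} ((pr₁* x ∪ u) ∪ pr₂* y)`
(`W.IsInducedBy`). The triple product is `(X × Y) × Z` with projections `p₁₂ = pr₁`,
`p₂₃ = proj₂₃`, `p₁₃ = proj₁₃`.

1. `pdEquiv`, `pushforward` (Kahn §3.5.1): Poincaré duality `H^d(U) ≃ (H^{d'}(U))^∨`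
   (`isPerfPair_cupPairing`) and the push-forward `f₊ : Hᵉ(V) → Hᵈ(U)` along `f : V → U`,
   *defined* as the adjoint of `f*`: `tr_U (f₊ α ∪ β) = tr_V (α ∪ f* β)`
   (`trace_cup_pushforward`).
2. `trace_cup_fst_eq_of_isInducedBy` (partial inducedness): for every `ν ∈ H(Y × Z)` of
   complementary degree, `tr_{Y×Z} (pr₁* (T x) ∪ ν) = tr_{X×Y×Z} (p₁₂* (pr₁* x ∪ u) ∪ p₂₃* ν)` —
   by Künneth induction on `ν` (for `ν = pr₁* a ∪ pr₂* b` both sides are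
   `tr_Y (T x ∪ a) · tr_Z b = tr_{X×Y} ((pr₁* x ∪ u) ∪ pr₂* a) · tr_Z b` in the top bidegree by
   `trace_externalCup` and the hypothesis on `T`, and `0` otherwise); and its companion
   `trace_cup_fst_eq_zero_of_lt`: the right-hand side vanishes identically when `i + 2a < 2nX`
   (no operator is induced from `Hⁱ(X)` then).
3. `trace_pairing_corrComp`: for the composite class `v ∘ u = p₁₃₊ (p₁₂* u ∪ p₂₃* v)`
   (`corrComp`), `tr_{X×Z} ((pr₁* x ∪ v∘u) ∪ pr₂* z) = tr_{X×Y×Z} (p₁₂* (pr₁* x ∪ u) ∪ p₂₃* (v ∪ pr₂* z))`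
   (adjunction 1., `map_cup`, `pullback_comp`, and the graded-commutative reshuffle
   `(x ∪ u) ∪ (v ∪ z) = (u ∪ v) ∪ (x ∪ z)`, sign-free as `|u| = 2a`, `|v| = 2b` are even).
4. `isInducedBy_comp_corrComp` (Kleiman §1.3; Fulton 16.1.2 (a); Kahn (3.5.1)): `S ∘ T` is
   induced by `v ∘ u` (3. and 2. with `ν = v ∪ pr₂* z`, then the hypothesis on `S`); and
   `trace_pairing_corrComp_eq_zero`: `v ∘ u` pairs to zero against `Hⁱ(X) ⊗ H^{j'}(Z)` when
   `i + 2a < 2nX`.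
5. `corrComp_mem_ratAlgebraicClasses`: `v ∘ u` is a rational algebraic class when `u`, `v` are:
   `p₁₂* u ∪ p₂₃* v` is (`pullback_ratAlgebraicClasses_le`, `cup_mem_ratAlgebraicClasses`), the
   pull-back `p₁₃*` is induced by the rational algebraic class of the transposed graph
   (`exists_isInducedBy_pullback`), hence its adjoint `p₁₃₊` is induced by the transposed class
   (`isInducedBy_transposeClass_of_adjoint`, rational algebraic by
   `pullback_ratAlgebraicClasses_le` along the braiding) and preserves rational algebraic
   classes (`map_ratAlgebraicClasses_of_isInducedBy`).
6. `isAlgebraicGradedOp_comp_holds`: `(S ∘ T)ᵢⱼ = Σₘ Sₘⱼ ∘ Tᵢₘ` is a finite sum (the components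
   vanish off the lines `2a + i = m + 2nX`, `2b + m = j + 2nY`); it is induced by
   `w_c = Σ_{a+b=c+nY} v_b ∘ u_a` (`compClasses`): the pairings of both sides are matched term by
   term along `m ↦ (a, b)` with `Finset.sum_bij_ne_zero`, using 4.; components of `S ∘ T` off
   the lines `2c + i = j + 2nX` vanish termwise.

Products of smooth projective varieties are smooth projective by
`IsSmoothProjective.tensor_holds`. No statement of `Correspondences.lean` is restated or
modified.

## References

* S. Kleiman, *Algebraic cycles and the Weil conjectures*, in: Dix exposés sur la cohomologie des
  schémas, North-Holland (1968), §1.3. [Kleiman1968AlgebraicCycles]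
* W. Fulton, *Intersection theory*, Springer (1984/1998), §16.1: Def. 16.1.1
  (`β ∘ α = p_{XZ*}(p_{XY}^* α · p_{YZ}^* β)`), Def. 16.1.2, Prop. 16.1.2 (a). [Fulton1998]
* B. Kahn, *Zeta and L-functions of varieties and motives*, LMS Lecture Note Series 462, CUP
  (2020), §3.5.1 (direct image, projection formula), Prop. 3.45, (3.5.1)–(3.5.2). [Kahn2020]
-/

universe u v

open CategoryTheory AlgebraicGeometry MonoidalCategory CartesianMonoidalCategory Opposite
open scoped TensorProduct DirectSum

noncomputable section

namespace Literature.AlgebraicGeometry.Motives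

/-! ## Projections of the triple product `(X × Y) × Z` -/

section Projections

variable {k : Type u} [Field k] (X Y Z : SchemeOver k)

/-- The projection `p₂₃ : (X × Y) × Z → Y × Z`. [folklore] -/
def proj₂₃ : (X ⊗ Y) ⊗ Z ⟶ Y ⊗ Z := lift (fst _ _ ≫ snd _ _) (snd _ _)

/-- The projection `p₁₃ : (X × Y) × Z → X × Z`. [folklore] -/
def proj₁₃ : (X ⊗ Y) ⊗ Z ⟶ X ⊗ Z := lift (fst _ _ ≫ fst _ _) (snd _ _)

/-- `p₂₃ ≫ pr₁ = p₁₂ ≫ pr₂` (the projection `π₂` to `Y`). [folklore] -/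
@[simp, reassoc]
lemma proj₂₃_fst : proj₂₃ X Y Z ≫ fst Y Z = fst (X ⊗ Y) Z ≫ snd X Y := lift_fst _ _

/-- `p₂₃ ≫ pr₂ = π₃`. [folklore] -/
@[simp, reassoc]
lemma proj₂₃_snd : proj₂₃ X Y Z ≫ snd Y Z = snd (X ⊗ Y) Z := lift_snd _ _

/-- `p₁₃ ≫ pr₁ = p₁₂ ≫ pr₁` (the projection `π₁` to `X`). [folklore] -/
@[simp, reassoc]
lemma proj₁₃_fst : proj₁₃ X Y Z ≫ fst X Z = fst (X ⊗ Y) Z ≫ fst X Y := lift_fst _ _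

/-- `p₁₃ ≫ pr₂ = π₃`. [folklore] -/
@[simp, reassoc]
lemma proj₁₃_snd : proj₁₃ X Y Z ≫ snd X Z = snd (X ⊗ Y) Z := lift_snd _ _

end Projections

namespace WeilCohomology

variable {k : Type u} [Field k] {K : Type v} [Field K] [CharZero K] (W : WeilCohomology k K)

/-! ## Pull-backs along the projections -/

section Pullbacks

variable {X Y Z : SchemeOver k}

/-- `p₂₃* pr₁* = p₁₂* pr₂*` (both are `π₂*`). [folklore] -/
lemma pullback_proj₂₃_fst (i : ℕ) (a : W.obj Y i) :
    W.pullback (proj₂₃ X Y Z) i (W.pullback (fst Y Z) i a) =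
      W.pullback (fst (X ⊗ Y) Z) i (W.pullback (snd X Y) i a) := by
  rw [← LinearMap.comp_apply, ← W.pullback_comp, proj₂₃_fst, W.pullback_comp,
    LinearMap.comp_apply]

/-- `p₂₃* pr₂* = π₃*`. [folklore] -/
lemma pullback_proj₂₃_snd (i : ℕ) (b : W.obj Z i) :
    W.pullback (proj₂₃ X Y Z) i (W.pullback (snd Y Z) i b) = W.pullback (snd (X ⊗ Y) Z) i b := by
  rw [← LinearMap.comp_apply, ← W.pullback_comp, proj₂₃_snd]

/-- `p₁₃* pr₁* = p₁₂* pr₁*` (both are `π₁*`). [folklore] -/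
lemma pullback_proj₁₃_fst (i : ℕ) (x : W.obj X i) :
    W.pullback (proj₁₃ X Y Z) i (W.pullback (fst X Z) i x) =
      W.pullback (fst (X ⊗ Y) Z) i (W.pullback (fst X Y) i x) := by
  rw [← LinearMap.comp_apply, ← W.pullback_comp, proj₁₃_fst, W.pullback_comp,
    LinearMap.comp_apply]

/-- `p₁₃* pr₂* = π₃*`. [folklore] -/
lemma pullback_proj₁₃_snd (i : ℕ) (z : W.obj Z i) :
    W.pullback (proj₁₃ X Y Z) i (W.pullback (snd X Z) i z) = W.pullback (snd (X ⊗ Y) Z) i z := by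
  rw [← LinearMap.comp_apply, ← W.pullback_comp, proj₁₃_snd]

end Pullbacks

/-! ## Poincaré duality and push-forward -/

section PD

variable {N M : ℕ} {V U : SchemeOver k}

/-- **Poincaré duality** as a linear equivalence `H^d(V) ≃ (H^{d'}(V))^∨`, `d + d' = 2 dim V`,
`a ↦ (b ↦ tr_V (a ∪ b))` (axiom (A), `isPerfPair_cupPairing`; Kleiman 1968 §1.2 (A)). [cite: Kleiman1968AlgebraicCycles, §1.2 (A)] -/
def pdEquiv (hV : IsSmoothProjective N V) {d d' : ℕ} (h : d + d' = 2 * N) :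
    W.obj V d ≃ₗ[K] Module.Dual K (W.obj V d') :=
  haveI := W.isPerfPair_cupPairing hV d d' h
  (W.cupPairing V N d d' h).toPerfPair

/-- `pdEquiv a b = tr (a ∪ b)`. [folklore] -/
@[simp]
lemma pdEquiv_apply (hV : IsSmoothProjective N V) {d d' : ℕ} (h : d + d' = 2 * N) (a : W.obj V d)
    (b : W.obj V d') : W.pdEquiv hV h a b = W.trace V N (W.cup h a b) := rfl

/-- The defining property of the inverse Poincaré duality map: `tr (PD⁻¹ φ ∪ b) = φ b`. [folklore] -/
lemma trace_cup_pdEquiv_symm (hV : IsSmoothProjective N V) {d d' : ℕ} (h : d + d' = 2 * N)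
    (φ : Module.Dual K (W.obj V d')) (b : W.obj V d') :
    W.trace V N (W.cup h ((W.pdEquiv hV h).symm φ) b) = φ b := by
  haveI := W.isPerfPair_cupPairing hV d d' h
  exact LinearMap.congr_fun (LinearMap.apply_symm_toPerfPair_self (W.cupPairing V N d d' h) φ) b

/-- **Push-forward** `f₊ : Hᵉ(V) → Hᵈ(U)` along `f : V → U` (`U` smooth projective of dimension
`M`, `e + d' = 2N`, `d + d' = 2M`), *defined* as the Poincaré-duality adjoint of
`f* : H^{d'}(U) → H^{d'}(V)` (Kahn 2020 §3.5.1; Kleiman 1968 §1.2): `f₊ α` is the class on `U`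
representing the functional `β ↦ tr_V^{(N)} (α ∪ f* β)` (`trace_cup_pushforward`). The implicit
parameter `N` is not tied to `V` (no hypothesis `IsSmoothProjective N V` is needed to define the
map): this is the geometric push-forward only when `N = dim V`, i.e. when `W.trace V N` is the
trace of `V`; for other `N` it is merely the adjoint of `f*` with respect to the degree-`(e, d')`
pairing `(α, γ) ↦ W.trace V N (α ∪ γ)`. All uses below take `N = dim V`. [cite: Kahn2020, §3.5.1] -/
def pushforward (hU : IsSmoothProjective M U) (f : V ⟶ U) {e d d' : ℕ} (he : e + d' = 2 * N)
    (hd : d + d' = 2 * M) : W.obj V e →ₗ[K] W.obj U d :=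
  (W.pdEquiv hU hd).symm.toLinearMap ∘ₗ (W.pullback f d').dualMap ∘ₗ W.cupPairing V N e d' he

/-- The adjunction `tr_U (f₊ α ∪ β) = tr_V (α ∪ f* β)` (Kahn 2020 §3.5.1, "`f_*` is adjoint to
`f^*` for the Poincaré pairing"). [cite: Kahn2020, §3.5.1] -/
lemma trace_cup_pushforward (hU : IsSmoothProjective M U) (f : V ⟶ U) {e d d' : ℕ}
    (he : e + d' = 2 * N) (hd : d + d' = 2 * M) (α : W.obj V e) (β : W.obj U d') :
    W.trace U M (W.cup hd (W.pushforward hU f he hd α) β) =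
      W.trace V N (W.cup he α (W.pullback f d' β)) := by
  simp only [pushforward, LinearMap.coe_comp, LinearEquiv.coe_coe, Function.comp_apply]
  rw [W.trace_cup_pdEquiv_symm hU hd]
  rfl

end PD

/-! ## Reassociation lemmas -/

section Reassoc

variable {n m : ℕ} {X Y : SchemeOver k}

/-- `pr₁* c ∪ (pr₁* a ∪ pr₂* b) = pr₁* (c ∪ a) ∪ pr₂* b` on `X × Y` (`cup_assoc`, `map_cup`);
degrees `|c| = i`, `|a| = s`, `|b| = t`, `s + t = d`, `i + d = N`, `i + s = e₁`, `e₁ + t = N`. [folklore] -/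
lemma cup_fst_externalCup (hX : IsSmoothProjective n X) (hY : IsSmoothProjective m Y)
    {i s t d e₁ N : ℕ} (hst : s + t = d) (he : i + d = N) (h₁ : i + s = e₁) (h' : e₁ + t = N)
    (c : W.obj X i) (a : W.obj X s) (b : W.obj Y t) :
    W.cup he (W.pullback (fst X Y) i c) (W.externalCup X Y hst a b) =
      W.externalCup X Y h' (W.cup h₁ c a) b := by
  have hXY := IsSmoothProjective.tensor_holds hX hY
  rw [externalCup_apply, externalCup_apply, ← W.cup_assoc hXY h₁ hst h' he,
    ← W.map_cup hXY hX (fst X Y) h₁]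

variable {V : SchemeOver k}

/-- The graded-commutative reshuffle `(A ∪ U) ∪ (V ∪ C) = (U ∪ V) ∪ (A ∪ C)` when `U` and `V`
have even degrees (`cup_comm` without signs, `cup_assoc`). [folklore] -/
lemma cup_cup_cup_comm_of_even (hV : IsSmoothProjective n V) {iA iU iV iC eAU eVC eUV eAC N : ℕ}
    (hUe : Even iU) (hVe : Even iV) (hAU : iA + iU = eAU) (hVC : iV + iC = eVC)
    (h₁ : eAU + eVC = N) (hUV : iU + iV = eUV) (hAC : iA + iC = eAC) (h₂ : eUV + eAC = N)
    (A : W.obj V iA) (U : W.obj V iU) (V' : W.obj V iV) (C : W.obj V iC) :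
    W.cup h₁ (W.cup hAU A U) (W.cup hVC V' C) = W.cup h₂ (W.cup hUV U V') (W.cup hAC A C) := by
  have hUA : iU + iA = eAU := by omega
  have h₃ : iU + (iA + eVC) = N := by omega
  have h₅ : iA + iV + iC = iA + eVC := by omega
  have hVA : iV + iA = iA + iV := by omega
  have h₆ : iV + eAC = iA + eVC := by omega
  rw [W.cup_comm_of_even hV hAU hUA (Or.inr hUe) A U, W.cup_assoc hV hUA rfl h₁ h₃,
    ← W.cup_assoc hV rfl hVC h₅ rfl A V' C, W.cup_comm_of_even hV rfl hVA (Or.inr hVe) A V',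
    W.cup_assoc hV hVA hAC h₅ h₆, ← W.cup_assoc hV hUV h₆ h₂ h₃]

end Reassoc

/-! ## Partial inducedness on `Y × Z` -/

section Partial

variable {nX nY nZ : ℕ} {X Y Z : SchemeOver k}

/-- **Partial inducedness** (base change of Kleiman's pairing identity to `Y × Z`): if
`T : Hⁱ(X) → Hᵐ(Y)` is induced by `u ∈ H²ᵃ(X × Y)`, then for every class `ν` on `Y × Z` of
complementary degree, `tr_{Y×Z} (pr₁* (T x) ∪ ν) = tr_{X×Y×Z} (p₁₂* (pr₁* x ∪ u) ∪ p₂₃* ν)`.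
By Künneth induction on `ν`: for `ν = pr₁* a ∪ pr₂* b` both sides equal
`tr_{X×Y} ((pr₁* x ∪ u) ∪ pr₂* a) · tr_Z b` in the top bidegree (`trace_externalCup`, the
hypothesis on `T`) and vanish otherwise. [cite: Kahn2020, §3.5.2 formulas (3.5.1)–(3.5.2)] -/
theorem trace_cup_fst_eq_of_isInducedBy (hX : IsSmoothProjective nX X)
    (hY : IsSmoothProjective nY Y) (hZ : IsSmoothProjective nZ Z) {a i m m' : ℕ}
    {u : W.obj (X ⊗ Y) (2 * a)} {T : W.obj X i →ₗ[K] W.obj Y m} {hmm' : m + m' = 2 * nY}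
    {hm : i + 2 * a + m' = 2 * (nX + nY)} (hT : W.IsInducedBy nX nY u T hmm' hm) {e : ℕ}
    (he : m + e = 2 * (nY + nZ)) (he' : i + 2 * a + e = 2 * (nX + nY + nZ)) (x : W.obj X i)
    (ν : W.obj (Y ⊗ Z) e) :
    W.trace (Y ⊗ Z) (nY + nZ) (W.cup he (W.pullback (fst Y Z) m (T x)) ν) =
      W.trace ((X ⊗ Y) ⊗ Z) (nX + nY + nZ) (W.cup he'
        (W.pullback (fst (X ⊗ Y) Z) (i + 2 * a) (W.cup rfl (W.pullback (fst X Y) i x) u))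
        (W.pullback (proj₂₃ X Y Z) e ν)) := by
  have hXY := IsSmoothProjective.tensor_holds hX hY
  have hYZ := IsSmoothProjective.tensor_holds hY hZ
  have hXYZ := IsSmoothProjective.tensor_holds hXY hZ
  induction ν using W.kunneth_induction hY hZ with
  | zero => simp
  | add w w' hw hw' => simp only [map_add, hw, hw']
  | ext α β hαβ a' b' =>
    rw [W.externalCup_apply, W.map_cup hXYZ hYZ (proj₂₃ X Y Z) hαβ, pullback_proj₂₃_fst,
      pullback_proj₂₃_snd, ← W.externalCup_apply, ← W.externalCup_apply]
    by_cases hβ : β = 2 * nZ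
    · subst hβ
      obtain rfl : α = m' := by omega
      rw [W.cup_fst_externalCup hY hZ hαβ he hmm' (by omega),
        W.cup_fst_externalCup hXY hZ hαβ he' hm (by omega), W.trace_externalCup hY hZ,
        W.trace_externalCup hXY hZ, hT x a']
    · rw [W.cup_fst_externalCup hY hZ hαβ he rfl (by omega),
        W.cup_fst_externalCup hXY hZ hαβ he' rfl (by omega),
        W.externalCup_eq_zero_of_ne hY hZ _ (by omega), W.externalCup_eq_zero_of_ne hXY hZ _
          (by omega), map_zero, map_zero]

/-- Companion of `trace_cup_fst_eq_of_isInducedBy` in the degenerate range `i + 2a < 2nX` (where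
no operator `Hⁱ(X) → H(Y)` is induced by `u ∈ H²ᵃ(X × Y)`): the pairing
`tr_{X×Y×Z} (p₁₂* (pr₁* x ∪ u) ∪ p₂₃* ν)` vanishes identically, since in each Künneth component
either the external product is off the top bidegree or the `Y`-factor lives above degree
`2nY`. [folklore] -/
theorem trace_cup_fst_eq_zero_of_lt (hX : IsSmoothProjective nX X) (hY : IsSmoothProjective nY Y)
    (hZ : IsSmoothProjective nZ Z) {a i e : ℕ} (hlt : i + 2 * a < 2 * nX)
    (he' : i + 2 * a + e = 2 * (nX + nY + nZ)) (x : W.obj X i) (u : W.obj (X ⊗ Y) (2 * a))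
    (ν : W.obj (Y ⊗ Z) e) :
    W.trace ((X ⊗ Y) ⊗ Z) (nX + nY + nZ) (W.cup he'
        (W.pullback (fst (X ⊗ Y) Z) (i + 2 * a) (W.cup rfl (W.pullback (fst X Y) i x) u))
        (W.pullback (proj₂₃ X Y Z) e ν)) = 0 := by
  have hXY := IsSmoothProjective.tensor_holds hX hY
  have hYZ := IsSmoothProjective.tensor_holds hY hZ
  have hXYZ := IsSmoothProjective.tensor_holds hXY hZ
  induction ν using W.kunneth_induction hY hZ with
  | zero => simp
  | add w w' hw hw' => simp only [map_add, hw, hw', add_zero]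
  | ext α β hαβ a' b' =>
    rw [W.externalCup_apply, W.map_cup hXYZ hYZ (proj₂₃ X Y Z) hαβ, pullback_proj₂₃_fst,
      pullback_proj₂₃_snd, ← W.externalCup_apply,
      W.cup_fst_externalCup hXY hZ hαβ he' rfl (by omega)]
    by_cases hβ : β = 2 * nZ
    · haveI := W.subsingleton_obj hY (i := α) (by omega)
      rw [Subsingleton.elim a' 0, map_zero, map_zero, LinearMap.map_zero₂, map_zero]
    · rw [W.externalCup_eq_zero_of_ne hXY hZ _ (by omega), map_zero]

end Partial

/-! ## Composite correspondences -/

section Comp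

variable {nX nY nZ : ℕ} {X Y Z : SchemeOver k}

/-- **Composite of correspondences** (Kleiman 1968 §1.3; Fulton Def. 16.1.1; Kahn (3.5.1)):
`v ∘ u = p₁₃₊ (p₁₂* u ∪ p₂₃* v) ∈ H²ᶜ(X × Z)` for `u ∈ H²ᵃ(X × Y)`, `v ∈ H²ᵇ(Y × Z)`,
`a + b = c + nY`; here `d'` with `2c + d' = 2(nX + nZ)` is the complementary degree used for the
Poincaré-duality adjoint `p₁₃₊` (`pushforward`). [cite: Fulton1998, Def. 16.1.1] -/
def corrComp (hX : IsSmoothProjective nX X) (hZ : IsSmoothProjective nZ Z) {a b c d' : ℕ}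
    (u : W.obj (X ⊗ Y) (2 * a)) (v : W.obj (Y ⊗ Z) (2 * b)) (hc : a + b = c + nY)
    (hd : 2 * c + d' = 2 * (nX + nZ)) : W.obj (X ⊗ Z) (2 * c) :=
  W.pushforward (N := nX + nY + nZ) (IsSmoothProjective.tensor_holds hX hZ) (proj₁₃ X Y Z)
    (e := 2 * (a + b)) (show 2 * (a + b) + d' = 2 * (nX + nY + nZ) by omega) hd
    (W.cup (show 2 * a + 2 * b = 2 * (a + b) by omega) (W.pullback (fst (X ⊗ Y) Z) (2 * a) u)
      (W.pullback (proj₂₃ X Y Z) (2 * b) v))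

/-- `corrComp` is additive in `u`. [folklore] -/
lemma corrComp_add_left (hX : IsSmoothProjective nX X) (hZ : IsSmoothProjective nZ Z)
    {a b c d' : ℕ} (u u' : W.obj (X ⊗ Y) (2 * a)) (v : W.obj (Y ⊗ Z) (2 * b))
    (hc : a + b = c + nY) (hd : 2 * c + d' = 2 * (nX + nZ)) :
    W.corrComp hX hZ (u + u') v hc hd = W.corrComp hX hZ u v hc hd + W.corrComp hX hZ u' v hc hd := by
  simp only [corrComp, map_add, LinearMap.add_apply]

/-- The pairing of the composite class: for `x ∈ Hⁱ(X)`, `z ∈ H^{j'}(Z)`,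
`tr_{X×Z} ((pr₁* x ∪ v∘u) ∪ pr₂* z) = tr_{X×Y×Z} (p₁₂* (pr₁* x ∪ u) ∪ p₂₃* (v ∪ pr₂* z))`
(adjunction `trace_cup_pushforward`, `map_cup`, `pullback_comp`, and the sign-free reshuffle
`cup_cup_cup_comm_of_even`). [cite: Kahn2020, §3.5.1–3.5.2] -/
theorem trace_pairing_corrComp (hX : IsSmoothProjective nX X) (hY : IsSmoothProjective nY Y)
    (hZ : IsSmoothProjective nZ Z) {a b c i j' : ℕ} (u : W.obj (X ⊗ Y) (2 * a))
    (v : W.obj (Y ⊗ Z) (2 * b)) (hc : a + b = c + nY) (hd : 2 * c + (i + j') = 2 * (nX + nZ))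
    (hm : i + 2 * c + j' = 2 * (nX + nZ)) (he' : i + 2 * a + (2 * b + j') = 2 * (nX + nY + nZ))
    (x : W.obj X i) (z : W.obj Z j') :
    W.trace (X ⊗ Z) (nX + nZ) (W.cup hm (W.cup rfl (W.pullback (fst X Z) i x)
        (W.corrComp hX hZ u v hc hd)) (W.pullback (snd X Z) j' z)) =
      W.trace ((X ⊗ Y) ⊗ Z) (nX + nY + nZ) (W.cup he'
        (W.pullback (fst (X ⊗ Y) Z) (i + 2 * a) (W.cup rfl (W.pullback (fst X Y) i x) u))
        (W.pullback (proj₂₃ X Y Z) (2 * b + j') (W.cup rfl v (W.pullback (snd Y Z) j' z)))) := by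
  have hXY := IsSmoothProjective.tensor_holds hX hY
  have hYZ := IsSmoothProjective.tensor_holds hY hZ
  have hXZ := IsSmoothProjective.tensor_holds hX hZ
  have hXYZ := IsSmoothProjective.tensor_holds hXY hZ
  -- move the composite class to the front on `X × Z`
  rw [W.cup_comm_of_even hXZ rfl (by omega : 2 * c + i = i + 2 * c) (Or.inr ⟨c, two_mul c⟩)
      (W.pullback (fst X Z) i x), W.cup_assoc hXZ (by omega : 2 * c + i = i + 2 * c) rfl hm hd]
  -- adjunction
  rw [corrComp, W.trace_cup_pushforward, W.map_cup hXYZ hXZ (proj₁₃ X Y Z),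
    pullback_proj₁₃_fst, pullback_proj₁₃_snd]
  -- expand the pull-backs on `(X × Y) × Z`
  rw [W.map_cup hXYZ hXY (fst (X ⊗ Y) Z), W.map_cup hXYZ hYZ (proj₂₃ X Y Z),
    pullback_proj₂₃_snd]
  -- reshuffle
  rw [W.cup_cup_cup_comm_of_even hXYZ ⟨a, two_mul a⟩ ⟨b, two_mul b⟩ rfl rfl he'
    (show 2 * a + 2 * b = 2 * (a + b) by omega) rfl
    (show 2 * (a + b) + (i + j') = 2 * (nX + nY + nZ) by omega)]

/-- **Composites of induced operators** (Kleiman 1968 §1.3, `v ∘ u = p₁₃₊ (p₁₂* u ∪ p₂₃* v)`;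
Fulton Prop. 16.1.2 (a) `(β ∘ α)_* = β_* ∘ α_*`; Kahn Prop. 3.45 / (3.5.1)): if
`T : Hⁱ(X) → Hᵐ(Y)` is induced by `u ∈ H²ᵃ(X × Y)` and `S : Hᵐ(Y) → Hʲ(Z)` by `v ∈ H²ᵇ(Y × Z)`,
then `S ∘ T` is induced by `v ∘ u ∈ H²ᶜ(X × Z)`, `a + b = c + nY`.

Depends only on: `IsSmoothProjective.tensor_holds`, `isPerfPair_cupPairing` (the adjoint
`p₁₃₊`), `bijective_kunnethMap`, `trace_externalCup`, `subsingleton_obj`, `cup_assoc`,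
`cup_comm`, `map_cup`, `pullback_comp`. [cite: Kleiman1968AlgebraicCycles, §1.3] [cite: Fulton1998, Prop. 16.1.2 (a)] -/
theorem isInducedBy_comp_corrComp (hX : IsSmoothProjective nX X) (hY : IsSmoothProjective nY Y)
    (hZ : IsSmoothProjective nZ Z) {a b c i m m' j j' : ℕ} {u : W.obj (X ⊗ Y) (2 * a)}
    {v : W.obj (Y ⊗ Z) (2 * b)} {T : W.obj X i →ₗ[K] W.obj Y m} {S : W.obj Y m →ₗ[K] W.obj Z j}
    {hmm' : m + m' = 2 * nY} {hmT : i + 2 * a + m' = 2 * (nX + nY)}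
    (hT : W.IsInducedBy nX nY u T hmm' hmT) {hjj' : j + j' = 2 * nZ}
    {hmS : m + 2 * b + j' = 2 * (nY + nZ)} (hS : W.IsInducedBy nY nZ v S hjj' hmS)
    (hc : a + b = c + nY) (hd : 2 * c + (i + j') = 2 * (nX + nZ))
    (hm : i + 2 * c + j' = 2 * (nX + nZ)) :
    W.IsInducedBy nX nZ (W.corrComp hX hZ u v hc hd) (S ∘ₗ T) hjj' hm := by
  have hYZ := IsSmoothProjective.tensor_holds hY hZ
  intro x z
  have he : m + (2 * b + j') = 2 * (nY + nZ) := by omega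
  rw [LinearMap.comp_apply, hS (T x) z, W.cup_assoc hYZ rfl rfl hmS he,
    W.trace_cup_fst_eq_of_isInducedBy hX hY hZ hT he (by omega) x,
    W.trace_pairing_corrComp hX hY hZ u v hc hd hm]

/-- In the degenerate range `i + 2a < 2nX` the composite class `v ∘ u` pairs to zero against
`Hⁱ(X) ⊗ H^{j'}(Z)` (`trace_pairing_corrComp` and `trace_cup_fst_eq_zero_of_lt`). [folklore] -/
theorem trace_pairing_corrComp_eq_zero (hX : IsSmoothProjective nX X)
    (hY : IsSmoothProjective nY Y) (hZ : IsSmoothProjective nZ Z) {a b c i j' : ℕ}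
    (u : W.obj (X ⊗ Y) (2 * a)) (v : W.obj (Y ⊗ Z) (2 * b)) (hc : a + b = c + nY)
    (hd : 2 * c + (i + j') = 2 * (nX + nZ)) (hm : i + 2 * c + j' = 2 * (nX + nZ))
    (hlt : i + 2 * a < 2 * nX) (x : W.obj X i) (z : W.obj Z j') :
    W.trace (X ⊗ Z) (nX + nZ) (W.cup hm (W.cup rfl (W.pullback (fst X Z) i x)
        (W.corrComp hX hZ u v hc hd)) (W.pullback (snd X Z) j' z)) = 0 := by
  rw [W.trace_pairing_corrComp hX hY hZ u v hc hd hm (by omega),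
    W.trace_cup_fst_eq_zero_of_lt hX hY hZ hlt]

/-- **Composites of algebraic correspondences are algebraic classes** (Kleiman 1968 §1.3;
Fulton 16.1.1; Kahn Lemma 3.59 (1)): if `u ∈ Aᵃ(X × Y)_ℚ` and `v ∈ Aᵇ(Y × Z)_ℚ` then
`v ∘ u ∈ Aᶜ(X × Z)_ℚ`. Indeed `p₁₂* u ∪ p₂₃* v` is rational algebraic
(`pullback_ratAlgebraicClasses_le`, `cup_mem_ratAlgebraicClasses`); `p₁₃*` is induced by the
rational algebraic class of the transposed graph (`exists_isInducedBy_pullback`), so its adjoint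
`p₁₃₊` is induced by the transpose of that class (`isInducedBy_transposeClass_of_adjoint`), again
rational algebraic, and therefore preserves rational algebraic classes
(`map_ratAlgebraicClasses_of_isInducedBy`). [cite: Kleiman1968AlgebraicCycles, §1.3] -/
theorem corrComp_mem_ratAlgebraicClasses (hX : IsSmoothProjective nX X)
    (hY : IsSmoothProjective nY Y) (hZ : IsSmoothProjective nZ Z) {a b c d' : ℕ}
    {u : W.obj (X ⊗ Y) (2 * a)} {v : W.obj (Y ⊗ Z) (2 * b)}
    (hu : u ∈ W.ratAlgebraicClasses (X ⊗ Y) a) (hv : v ∈ W.ratAlgebraicClasses (Y ⊗ Z) b)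
    (hc : a + b = c + nY) (hd : 2 * c + d' = 2 * (nX + nZ)) :
    W.corrComp hX hZ u v hc hd ∈ W.ratAlgebraicClasses (X ⊗ Z) c := by
  have hXY := IsSmoothProjective.tensor_holds hX hY
  have hYZ := IsSmoothProjective.tensor_holds hY hZ
  have hXZ := IsSmoothProjective.tensor_holds hX hZ
  have hXYZ := IsSmoothProjective.tensor_holds hXY hZ
  -- the class `p₁₂* u ∪ p₂₃* v` is rational algebraic
  have hμ : W.cup (show 2 * a + 2 * b = 2 * (a + b) by omega)
      (W.pullback (fst (X ⊗ Y) Z) (2 * a) u) (W.pullback (proj₂₃ X Y Z) (2 * b) v) ∈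
      W.ratAlgebraicClasses ((X ⊗ Y) ⊗ Z) (a + b) :=
    W.cup_mem_ratAlgebraicClasses hXYZ rfl _ _
      (W.pullback_ratAlgebraicClasses_le hXYZ hXY (fst (X ⊗ Y) Z) a ⟨u, hu, rfl⟩)
      (W.pullback_ratAlgebraicClasses_le hXYZ hYZ (proj₂₃ X Y Z) b ⟨v, hv, rfl⟩)
  -- `p₁₃*` is induced by the transposed graph class `γ`
  obtain ⟨γ, hγ, hγi⟩ := W.exists_isInducedBy_pullback hXYZ hXZ (proj₁₃ X Y Z)
  have he : 2 * (a + b) + d' = 2 * (nX + nY + nZ) := by omega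
  -- its adjoint `p₁₃₊` is induced by `σ* γ`
  have hind : W.IsInducedBy (nX + nY + nZ) (nX + nZ) (W.transposeClass γ)
      (W.pushforward (N := nX + nY + nZ) hXZ (proj₁₃ X Y Z) (e := 2 * (a + b)) he hd)
      hd (show 2 * (a + b) + 2 * (nX + nZ) + d' = 2 * (nX + nY + nZ + (nX + nZ)) by omega) := by
    refine W.isInducedBy_transposeClass_of_adjoint hXZ hXYZ
      (hγi d' (2 * (a + b)) (by omega)) (by omega : d' + 2 * c = 2 * (nX + nZ)) ?_ hd _
    intro β μ
    change W.trace _ _ (W.cup _ (W.pullback (proj₁₃ X Y Z) d' β) μ) =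
      W.trace _ _ (W.cup _ β (W.pushforward hXZ (proj₁₃ X Y Z) he hd μ))
    rw [W.cup_comm_of_even hXYZ _ he (Or.inr ⟨a + b, two_mul _⟩),
      W.cup_comm_of_even hXZ _ hd (Or.inr ⟨c, two_mul c⟩), W.trace_cup_pushforward]
  exact W.map_ratAlgebraicClasses_of_isInducedBy hXYZ hXZ (W.transposeClass γ) _ hd _
    (W.pullback_ratAlgebraicClasses_le (IsSmoothProjective.tensor_holds hXYZ hXZ)
      (IsSmoothProjective.tensor_holds hXZ hXYZ) (β_ _ _).hom (nX + nZ) ⟨γ, hγ, rfl⟩)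
    hind _ hμ

/-- In the degenerate range `2(nX + nY) < i + 2a` (where the would-be middle degree exceeds
`2nY`) the composite class `v ∘ u` pairs to zero against `Hⁱ(X) ⊗ H^{j'}(Z)`:
`pr₁* x ∪ u ∈ H^{i+2a}(X × Y) = 0`. [folklore] -/
theorem trace_pairing_corrComp_eq_zero' (hX : IsSmoothProjective nX X)
    (hY : IsSmoothProjective nY Y) (hZ : IsSmoothProjective nZ Z) {a b c i j' : ℕ}
    (u : W.obj (X ⊗ Y) (2 * a)) (v : W.obj (Y ⊗ Z) (2 * b)) (hc : a + b = c + nY)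
    (hd : 2 * c + (i + j') = 2 * (nX + nZ)) (hm : i + 2 * c + j' = 2 * (nX + nZ))
    (hlt : 2 * (nX + nY) < i + 2 * a) (x : W.obj X i) (z : W.obj Z j') :
    W.trace (X ⊗ Z) (nX + nZ) (W.cup hm (W.cup rfl (W.pullback (fst X Z) i x)
        (W.corrComp hX hZ u v hc hd)) (W.pullback (snd X Z) j' z)) = 0 := by
  haveI := W.subsingleton_obj (IsSmoothProjective.tensor_holds hX hY) hlt
  rw [W.trace_pairing_corrComp hX hY hZ u v hc hd hm (by omega),
    Subsingleton.elim (W.cup rfl (W.pullback (fst X Y) i x) u) 0, map_zero, LinearMap.map_zero₂,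
    map_zero]

end Comp

/-! ## The composite of algebraic graded operators -/

section Assembly

variable {nX nY nZ : ℕ} {X Y Z : SchemeOver k}

variable (nY) in
/-- The classes inducing a composite of algebraic graded operators: in degree `2c`,
`w_c = Σ_{a + b = c + nY} v_b ∘ u_a` (Kleiman 1968 §1.3), and `0` for `c > nX + nZ` (where
`H²ᶜ(X × Z) = 0` and no bidegree is concerned). [cite: Kleiman1968AlgebraicCycles, §1.3] -/
def compClasses (hX : IsSmoothProjective nX X) (hZ : IsSmoothProjective nZ Z)
    (u : ∀ c : ℕ, W.obj (X ⊗ Y) (2 * c)) (v : ∀ c : ℕ, W.obj (Y ⊗ Z) (2 * c)) (c : ℕ) :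
    W.obj (X ⊗ Z) (2 * c) :=
  if h : c ≤ nX + nZ then
    ∑ ab ∈ Finset.antidiagonal (c + nY),
      if hab : ab.1 + ab.2 = c + nY then
        W.corrComp hX hZ (u ab.1) (v ab.2) hab
          (show 2 * c + (2 * (nX + nZ) - 2 * c) = 2 * (nX + nZ) by omega)
      else 0
  else 0

/-- `compClasses` in a degree `c ≤ nX + nZ`, with a prescribed complementary degree `d'`. [folklore] -/
lemma compClasses_eq (hX : IsSmoothProjective nX X) (hZ : IsSmoothProjective nZ Z)
    (u : ∀ c : ℕ, W.obj (X ⊗ Y) (2 * c)) (v : ∀ c : ℕ, W.obj (Y ⊗ Z) (2 * c)) {c d' : ℕ}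
    (hd : 2 * c + d' = 2 * (nX + nZ)) :
    W.compClasses nY hX hZ u v c = ∑ ab ∈ Finset.antidiagonal (c + nY),
      if hab : ab.1 + ab.2 = c + nY then W.corrComp hX hZ (u ab.1) (v ab.2) hab hd else 0 := by
  obtain rfl : d' = 2 * (nX + nZ) - 2 * c := by omega
  rw [compClasses, dif_pos (show c ≤ nX + nZ by omega)]

/-- The classes `compClasses` are rational algebraic when all `u_a`, `v_b` are
(`corrComp_mem_ratAlgebraicClasses`). [folklore] -/
lemma compClasses_mem (hX : IsSmoothProjective nX X) (hY : IsSmoothProjective nY Y)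
    (hZ : IsSmoothProjective nZ Z) {u : ∀ c : ℕ, W.obj (X ⊗ Y) (2 * c)}
    {v : ∀ c : ℕ, W.obj (Y ⊗ Z) (2 * c)} (hu : ∀ c, u c ∈ W.ratAlgebraicClasses (X ⊗ Y) c)
    (hv : ∀ c, v c ∈ W.ratAlgebraicClasses (Y ⊗ Z) c) (c : ℕ) :
    W.compClasses nY hX hZ u v c ∈ W.ratAlgebraicClasses (X ⊗ Z) c := by
  unfold compClasses
  split_ifs with h
  · refine sum_mem fun ab _ ↦ ?_
    split_ifs with hab
    · exact W.corrComp_mem_ratAlgebraicClasses hX hY hZ (hu _) (hv _) hab _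
    · exact zero_mem _
  · exact zero_mem _

/-- **Composites of algebraic correspondences are algebraic**: discharge of the named fact
`isAlgebraicGradedOp_comp` (Kleiman 1968 §1.3, formula `v ∘ u = p₁₃₊ (p₁₂* u ∪ p₂₃* v)`;
Fulton Def. 16.1.1 and Prop. 16.1.2 (a); Kahn Prop. 3.45, (3.5.1)). The component
`(S ∘ T)ᵢⱼ = Σₘ Sₘⱼ ∘ Tᵢₘ` is a finite sum (only `m ≤ j + 2nY` contribute); for `2c + i = j + 2nX`
it is induced by `w_c = Σ_{a+b=c+nY} v_b ∘ u_a` (`compClasses`, rational algebraic by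
`compClasses_mem`): the pairings `tr_Z (Sₘⱼ Tᵢₘ x ∪ z)` and
`tr_{X×Z} ((pr₁* x ∪ v_b ∘ u_a) ∪ pr₂* z)` agree along `m ↦ (a, b)`, `2a + i = m + 2nX`,
`2b + m = j + 2nY` (`isInducedBy_comp_corrComp`), the remaining terms on either side being zero
(`trace_pairing_corrComp_eq_zero`, `trace_pairing_corrComp_eq_zero'`, vanishing of `Tᵢₘ`, `Sₘⱼ`
off their lines); off the lines `2c + i = j + 2nX` every `Sₘⱼ ∘ Tᵢₘ` vanishes.
[cite: Kleiman1968AlgebraicCycles, §1.3] [cite: Fulton1998, Def. 16.1.1 and Prop. 16.1.2 (a)] [cite: Kahn2020, §3.5.2 Prop. 3.45 and (3.5.1)] -/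
theorem isAlgebraicGradedOp_comp_holds :
    isAlgebraicGradedOp_comp (W := W) (nX := nX) (nY := nY) (nZ := nZ) (X := X) (Y := Y)
      (Z := Z) := by
  intro hX hY hZ S T hS hT
  obtain ⟨v, hv, hv0⟩ := hS
  obtain ⟨u, hu, hu0⟩ := hT
  -- the sum over the middle degree is finite
  have hfin : ∀ i j : ℕ, PreWeilCohomology.GradedOp.comp S T i j =
      ∑ m ∈ Finset.range (j + 2 * nY + 1), (S m j).comp (T i m) := by
    intro i j
    refine finsum_eq_sum_of_support_subset _ fun m hm ↦ ?_
    rw [Finset.coe_range, Set.mem_Iio]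
    by_contra hmj
    refine hm ?_
    change (S m j).comp (T i m) = 0
    rw [hv0 m j (fun ⟨b, hb⟩ ↦ by omega), LinearMap.zero_comp]
  refine ⟨fun c ↦ ⟨W.compClasses nY hX hZ (fun c ↦ (u c : W.obj (X ⊗ Y) (2 * c)))
    (fun c ↦ (v c : W.obj (Y ⊗ Z) (2 * c))) c,
    W.compClasses_mem hX hY hZ (fun c ↦ (u c).2) (fun c ↦ (v c).2) c⟩, ?_, ?_⟩
  · intro i j c j' hj hm hc x z
    have hd : 2 * c + (i + j') = 2 * (nX + nZ) := by omega
    dsimp only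
    rw [hfin i j, W.compClasses_eq hX hZ _ _ hd]
    simp only [LinearMap.sum_apply, map_sum, LinearMap.comp_apply]
    -- the matching of the two sums, term by term
    have key : ∀ (m a b m' : ℕ), 2 * a + i = m + 2 * nX → 2 * b + m = j + 2 * nY →
        ∀ hmm' : m + m' = 2 * nY,
        W.trace Z nZ (W.cup hj (S m j (T i m x)) z) =
          W.trace (X ⊗ Z) (nX + nZ) (W.cup hm (W.cup rfl (W.pullback (fst X Z) i x)
            (if hab : (a, b).1 + (a, b).2 = c + nY then
              W.corrComp hX hZ (u (a, b).1 : W.obj (X ⊗ Y) (2 * (a, b).1))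
                (v (a, b).2 : W.obj (Y ⊗ Z) (2 * (a, b).2)) hab hd else 0))
            (W.pullback (snd X Z) j' z)) := by
      intro m a b m' ha hb hmm'
      have hab : a + b = c + nY := by omega
      rw [dif_pos hab]
      exact W.isInducedBy_comp_corrComp hX hY hZ (hu i m a m' hmm' (by omega) ha)
        (hv m j b j' hj (by omega) hb) hab hd hm x z
    have hA : ∀ m, W.trace Z nZ (W.cup hj (S m j (T i m x)) z) ≠ 0 →
        ∃ a, 2 * a + i = m + 2 * nX := fun m hne ↦ by
      by_contra h
      exact hne (by rw [hu0 i m h, LinearMap.zero_apply, map_zero, LinearMap.map_zero₂, map_zero])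
    have hB : ∀ m, W.trace Z nZ (W.cup hj (S m j (T i m x)) z) ≠ 0 →
        ∃ b, 2 * b + m = j + 2 * nY := fun m hne ↦ by
      by_contra h
      exact hne (by rw [hv0 m j h, LinearMap.zero_apply, LinearMap.map_zero₂, map_zero])
    have hM : ∀ m, W.trace Z nZ (W.cup hj (S m j (T i m x)) z) ≠ 0 → m ≤ 2 * nY := fun m hne ↦ by
      by_contra h
      haveI := W.subsingleton_obj hY (i := m) (by omega)
      exact hne (by rw [Subsingleton.elim (T i m x) 0, map_zero, LinearMap.map_zero₂, map_zero])
    refine Finset.sum_bij_ne_zero (fun m _ _ ↦ ((m + 2 * nX - i) / 2, (j + 2 * nY - m) / 2))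
      ?_ ?_ ?_ ?_
    · intro m _ hne
      obtain ⟨a, ha⟩ := hA m hne
      obtain ⟨b, hb⟩ := hB m hne
      rw [Finset.mem_antidiagonal]
      omega
    · intro m₁ _ hne₁ m₂ _ hne₂ heq
      obtain ⟨a₁, ha₁⟩ := hA m₁ hne₁
      obtain ⟨a₂, ha₂⟩ := hA m₂ hne₂
      simp only [Prod.mk.injEq] at heq
      omega
    · rintro ⟨a, b⟩ hab hne
      rw [Finset.mem_antidiagonal] at hab
      have hab' : a + b = c + nY := hab
      have h₁ : 2 * nX ≤ i + 2 * a := by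
        by_contra hlt
        exact hne (by rw [dif_pos hab', W.trace_pairing_corrComp_eq_zero hX hY hZ _ _ hab' hd hm
          (by omega)])
      have h₂ : i + 2 * a ≤ 2 * (nX + nY) := by
        by_contra hlt
        exact hne (by rw [dif_pos hab', W.trace_pairing_corrComp_eq_zero' hX hY hZ _ _ hab' hd hm
          (by omega)])
      have hkey := key (i + 2 * a - 2 * nX) a b (2 * (nX + nY) - i - 2 * a) (by omega) (by omega)
        (by omega)
      refine ⟨i + 2 * a - 2 * nX, ?_, ?_, ?_⟩
      · rw [Finset.mem_range]
        omega
      · rwa [hkey]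
      · simp only [Prod.mk.injEq]
        omega
    · intro m _ hne
      obtain ⟨a, ha⟩ := hA m hne
      obtain ⟨b, hb⟩ := hB m hne
      have hm2 := hM m hne
      obtain rfl : a = (m + 2 * nX - i) / 2 := by omega
      obtain rfl : b = (j + 2 * nY - m) / 2 := by omega
      exact key m _ _ (2 * nY - m) ha hb (by omega)
  · intro i j hne
    rw [hfin i j]
    refine Finset.sum_eq_zero fun m _ ↦ ?_
    by_cases hi : 2 * nX < i
    · haveI := W.subsingleton_obj hX hi
      ext x
      rw [Subsingleton.elim x 0, map_zero, map_zero]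
    by_cases ha : ∃ a, 2 * a + i = m + 2 * nX
    · by_cases hb : ∃ b, 2 * b + m = j + 2 * nY
      · obtain ⟨a, ha⟩ := ha
        obtain ⟨b, hb⟩ := hb
        exact absurd ⟨a + b - nY, by omega⟩ hne
      · rw [hv0 m j hb, LinearMap.zero_comp]
    · rw [hu0 i m ha, LinearMap.comp_zero]

end Assembly

end WeilCohomology

end Literature.AlgebraicGeometry.Motives

end
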